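import Summits.Schanuel.Schanuel.Theorems.ZilberEacResonantWitness
import Summits.Schanuel.Schanuel.Theorems.ZilberEacRealFibreZeros
import HarnessLib

/-!
# The equimodular class, IX: a relation `H(x₀, y₁) = 0` along points `y₁ = e_k·w_k` with
# `|e_k| = 1`, `w_k → w₀ ≠ 0`, `‖x₀‖ → ∞` forces the phases `e_k` to ACCUMULATE at a finite set

HONEST FRAMING.  Cell `pub-schanuel` (Zilber's Exponential-Algebraic Closedness, case ladder;
host summit Schanuel), seat 2, gen 22.  Analytic input for the NON-resonant members of the
equimodular class: **`phases_near_finset_of_relation`** — if `H ∈ ℂ[s][t]` is nonzero and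
`H(z_k, e_k w_k) = 0` for all `k`, where `‖z_k‖ → ∞`, `‖e_k‖ = 1`, `w_k → w₀ ≠ 0`, then there is a
finite `F ⊆ ℂ` (the unimodular roots of the leading form `Q(ζ) = Σ_{deg h_j = D} lc(h_j) w₀^j ζ^j`)
such that for every `ε > 0`, eventually `dist(e_k, F) < ε`.  Proof: divide by `z_k^D` (`D` the
largest `s`-degree), pass to the limit (`Q(e_k) → 0`), and use compactness of the unit circle minus
`ε`-neighbourhoods of `F`.  Combined with file VIII (non-resonant phases do NOT accumulate) this
contradicts a relation on all exponential points.  Part C supplies the exponential points with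
EVERY large label `k` (**`exists_expPoint_near_label`**: zero persistence for
`Φ(u, ζ) = Ã(u,ζ)e^{τ'}e^ζ + B̃(u,ζ)` at `u = 1/(τ' + 2πik) → 0`, whose limit `lc A·e^{τ'}(e^ζ - 1)` has
the simple zero `ζ = 0`).  [folklore]; nothing here is specific to Schanuel's conjecture.
-/

noncomputable section

open Filter Topology Polynomial Complex Metric
open Literature.NumberTheory.Transcendental

set_option linter.dupNamespace false

namespace Summit.Schanuel.Schanuel.Theorems

/-! ## Part A. Leading behaviour of a polynomial along `z → ∞` -/

/-- `h(z_k)/z_k^D → h_D` when `deg h ≤ D` and `‖z_k‖ → ∞`. [folklore] -/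
theorem tendsto_eval_div_pow {h : ℂ[X]} {D : ℕ} (hD : h.natDegree ≤ D) {z : ℕ → ℂ}
    (hz : Tendsto (fun k => ‖z k‖) atTop atTop) :
    Tendsto (fun k => h.eval (z k) / z k ^ D) atTop (𝓝 (h.coeff D)) := by
  -- `h(z)/z^D = Σ_i h_i (1/z)^{D-i}`, a polynomial in `u = 1/z`, continuous at `u = 0`
  have hinv : Tendsto (fun k => (z k)⁻¹) atTop (𝓝 (0 : ℂ)) :=
    tendsto_inv₀_cobounded.comp (tendsto_norm_atTop_iff_cobounded.1 hz)
  have hcont : Tendsto (fun k => ∑ i ∈ Finset.range (D + 1), h.coeff i * ((z k)⁻¹) ^ (D - i)) atTop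
      (𝓝 (h.coeff D)) := by
    have h1 := ((analyticAt_revSum h D 0).continuousAt.tendsto).comp hinv
    rwa [revSum_zero] at h1
  refine hcont.congr' ?_
  filter_upwards [hz.eventually_gt_atTop 0] with k hk
  have hzk : z k ≠ 0 := norm_pos_iff.1 hk
  rw [← pow_mul_eval_inv_eq_sum h hD (inv_ne_zero hzk), inv_inv, inv_pow, div_eq_inv_mul]

/-! ## Part B. Accumulation of the phases -/

/-- **A nonzero polynomial is small only near its roots** (on the unit circle): if `Q ≠ 0` and
`Q(e_k) → 0` with `‖e_k‖ = 1`, then for every `ε > 0`, eventually `e_k` is within `ε` of a root of `Q`.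
[folklore] -/
theorem eventually_near_roots_of_tendsto_zero {Q : ℂ[X]} (hQ : Q ≠ 0) {e : ℕ → ℂ}
    (he : ∀ k, ‖e k‖ = 1) (hlim : Tendsto (fun k => Q.eval (e k)) atTop (𝓝 0)) {ε : ℝ} (hε : 0 < ε) :
    ∀ᶠ k in atTop, ∃ ζ ∈ Q.roots.toFinset, ‖e k - ζ‖ < ε := by
  classical
  -- the compact set of unit vectors `ε`-far from all roots
  set C : Set ℂ := sphere (0 : ℂ) 1 ∩ ⋂ ζ ∈ Q.roots.toFinset, {u | ε ≤ ‖u - ζ‖} with hC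
  have hCc : IsCompact C := by
    refine (isCompact_sphere 0 1).inter_right ?_
    refine isClosed_biInter fun ζ _ => ?_
    exact isClosed_le continuous_const (continuous_id.sub continuous_const).norm
  by_cases hCne : C.Nonempty
  · obtain ⟨u₀, hu₀C, hmin⟩ :=
      hCc.exists_isMinOn hCne ((Polynomial.continuous Q).norm.continuousOn)
    have hm : 0 < ‖Q.eval u₀‖ := by
      rw [norm_pos_iff]
      intro h0
      have hroot : u₀ ∈ Q.roots.toFinset := by
        rw [Multiset.mem_toFinset, Polynomial.mem_roots hQ]; exact h0
      have := (Set.mem_iInter₂.1 hu₀C.2) u₀ hroot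
      simp only [Set.mem_setOf_eq, sub_self, norm_zero] at this
      exact absurd this (not_le.2 hε)
    have hev : ∀ᶠ k in atTop, ‖Q.eval (e k)‖ < ‖Q.eval u₀‖ := by
      have := (tendsto_norm.comp hlim)
      rw [norm_zero] at this
      exact this.eventually (gt_mem_nhds hm)
    filter_upwards [hev] with k hk
    by_contra hcon
    push Not at hcon
    have hkC : e k ∈ C := by
      refine ⟨by simp [he k], Set.mem_iInter₂.2 fun ζ hζ => hcon ζ hζ⟩
    exact absurd (hmin hkC) (not_le.2 hk)
  · -- `C = ∅`: every unit vector is `ε`-close to a root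
    refine Eventually.of_forall fun k => ?_
    by_contra hcon
    push Not at hcon
    exact hCne ⟨e k, by simp [he k], Set.mem_iInter₂.2 fun ζ hζ => hcon ζ hζ⟩

/-- **Phases accumulate at a finite set under a relation.**  `H ≠ 0` in `ℂ[s][t]`,
`H(z_k, e_k w_k) = 0` for all `k`, `‖z_k‖ → ∞`, `‖e_k‖ = 1`, `w_k → w₀ ≠ 0` ⟹ there is a finite
`F ⊆ ℂ` such that for every `ε > 0`, eventually some `ζ ∈ F` has `‖e_k - ζ‖ < ε`. [folklore] (new in
this form) -/
theorem phases_near_finset_of_relation {H : ℂ[X][X]} (hH0 : H ≠ 0) {z : ℕ → ℂ}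
    (hz : Tendsto (fun k => ‖z k‖) atTop atTop) {e w : ℕ → ℂ} (he : ∀ k, ‖e k‖ = 1) {w₀ : ℂ}
    (hw₀ : w₀ ≠ 0) (hw : Tendsto w atTop (𝓝 w₀))
    (hrel : ∀ k, (H.map (Polynomial.evalRingHom (z k))).eval (e k * w k) = 0) :
    ∃ F : Finset ℂ, ∀ ε : ℝ, 0 < ε → ∀ᶠ k in atTop, ∃ ζ ∈ F, ‖e k - ζ‖ < ε := by
  classical
  -- the largest `s`-degree `D` and an index where it is attained with nonzero top coefficient
  set M := H.natDegree with hM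
  set D : ℕ := (Finset.range (M + 1)).sup fun j => (H.coeff j).natDegree with hD
  have hDj : ∀ j ∈ Finset.range (M + 1), (H.coeff j).natDegree ≤ D := fun j hj =>
    Finset.le_sup (f := fun j => (H.coeff j).natDegree) hj
  have hexj : ∃ j ∈ Finset.range (M + 1), (H.coeff j).coeff D ≠ 0 := by
    obtain ⟨j₀, hj₀, hj₀D⟩ := Finset.exists_mem_eq_sup (Finset.range (M + 1))
      ⟨0, Finset.mem_range.2 (Nat.succ_pos M)⟩ fun j => (H.coeff j).natDegree
    by_cases h0 : H.coeff j₀ = 0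
    · -- then `D = 0`; use the leading coefficient of `H`
      have hD0 : D = 0 := by rw [hD, hj₀D, h0, Polynomial.natDegree_zero]
      refine ⟨M, Finset.self_mem_range_succ M, ?_⟩
      have hlead : H.coeff M ≠ 0 := Polynomial.leadingCoeff_ne_zero.2 hH0
      have hdeg : (H.coeff M).natDegree = 0 := by
        have := hDj M (Finset.self_mem_range_succ M); omega
      rw [hD0]
      intro hc
      apply hlead
      rw [Polynomial.eq_C_of_natDegree_eq_zero hdeg, hc, map_zero]
    · refine ⟨j₀, hj₀, ?_⟩
      rw [hD, hj₀D]
      exact Polynomial.leadingCoeff_ne_zero.2 h0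
  -- the leading form `Q`
  set Q : ℂ[X] := ∑ j ∈ Finset.range (M + 1), Polynomial.C ((H.coeff j).coeff D * w₀ ^ j) *
    Polynomial.X ^ j with hQ
  have hQcoeff : ∀ i, Q.coeff i = if i < M + 1 then (H.coeff i).coeff D * w₀ ^ i else 0 := by
    intro i
    rw [hQ, Polynomial.finsetSum_coeff]
    simp only [Polynomial.coeff_C_mul_X_pow]
    rw [Finset.sum_ite_eq (Finset.range (M + 1)) i]
    simp only [Finset.mem_range]
  have hQ0 : Q ≠ 0 := by
    obtain ⟨j, hj, hjc⟩ := hexj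
    intro h
    have := hQcoeff j
    rw [h, Polynomial.coeff_zero, if_pos (Finset.mem_range.1 hj)] at this
    exact mul_ne_zero hjc (pow_ne_zero _ hw₀) this.symm
  refine ⟨Q.roots.toFinset, fun ε hε => eventually_near_roots_of_tendsto_zero hQ0 he ?_ hε⟩
  -- `Q(e_k) → 0`
  have hQeval : ∀ k, Q.eval (e k) = ∑ j ∈ Finset.range (M + 1), (H.coeff j).coeff D * w₀ ^ j * e k ^ j := by
    intro k
    rw [hQ, Polynomial.eval_finsetSum]
    simp only [Polynomial.eval_mul, Polynomial.eval_C, Polynomial.eval_pow, Polynomial.eval_X]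
  -- the normalised relation `Σ_j (h_j(z_k)/z_k^D) (e_k w_k)^j = 0`
  have hS : ∀ᶠ k in atTop, ∑ j ∈ Finset.range (M + 1),
      (H.coeff j).eval (z k) / z k ^ D * (e k * w k) ^ j = 0 := by
    filter_upwards [hz.eventually_gt_atTop 0] with k hk
    have hzk : z k ^ D ≠ 0 := pow_ne_zero _ (norm_pos_iff.1 hk)
    have h1 := hrel k
    rw [evalPP_eq_sum H (z k) (e k * w k) (Nat.lt_succ_self _)] at h1
    have : ∑ j ∈ Finset.range (M + 1), (H.coeff j).eval (z k) / z k ^ D * (e k * w k) ^ j =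
        (∑ j ∈ Finset.range (M + 1), (H.coeff j).eval (z k) * (e k * w k) ^ j) / z k ^ D := by
      rw [Finset.sum_div]
      refine Finset.sum_congr rfl fun j _ => ?_
      ring
    rw [this, h1, zero_div]
  -- bound `‖Q(e_k)‖` by a sequence free of `e_k` that tends to `0`
  have hbound : ∀ᶠ k in atTop, ‖Q.eval (e k)‖ ≤ ∑ j ∈ Finset.range (M + 1),
      (‖(H.coeff j).eval (z k) / z k ^ D - (H.coeff j).coeff D‖ * ‖w k‖ ^ j +
        ‖(H.coeff j).coeff D‖ * ‖w k ^ j - w₀ ^ j‖) := by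
    filter_upwards [hS] with k hk
    have e1 : Q.eval (e k) = Q.eval (e k) - ∑ j ∈ Finset.range (M + 1),
        (H.coeff j).eval (z k) / z k ^ D * (e k * w k) ^ j := by rw [hk, sub_zero]
    rw [e1, hQeval, ← Finset.sum_sub_distrib]
    refine (norm_sum_le _ _).trans (Finset.sum_le_sum fun j _ => ?_)
    have e2 : (H.coeff j).coeff D * w₀ ^ j * e k ^ j - (H.coeff j).eval (z k) / z k ^ D * (e k * w k) ^ j =
        -(((H.coeff j).eval (z k) / z k ^ D - (H.coeff j).coeff D) * (e k ^ j * w k ^ j)) -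
          (H.coeff j).coeff D * (e k ^ j * (w k ^ j - w₀ ^ j)) := by ring
    rw [e2]
    refine (norm_sub_le _ _).trans ?_
    rw [norm_neg, norm_mul, norm_mul, norm_mul, norm_mul, norm_pow, he k, one_pow, one_mul, one_mul,
      norm_pow]
  have hB : Tendsto (fun k => ∑ j ∈ Finset.range (M + 1),
      (‖(H.coeff j).eval (z k) / z k ^ D - (H.coeff j).coeff D‖ * ‖w k‖ ^ j +
        ‖(H.coeff j).coeff D‖ * ‖w k ^ j - w₀ ^ j‖)) atTop (𝓝 0) := by
    rw [show (0 : ℝ) = ∑ j ∈ Finset.range (M + 1), (0 * ‖w₀‖ ^ j + ‖(H.coeff j).coeff D‖ * 0) by simp]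
    refine tendsto_finsetSum _ fun j hj => ?_
    refine Tendsto.add ?_ ?_
    · refine Tendsto.mul ?_ ((continuous_norm.tendsto w₀).comp hw |>.pow j)
      have h1 := tendsto_eval_div_pow (hDj j hj) hz
      have h2 := (h1.sub_const ((H.coeff j).coeff D)).norm
      simpa using h2
    · refine Tendsto.mul tendsto_const_nhds ?_
      have h1 : Tendsto (fun k => w k ^ j - w₀ ^ j) atTop (𝓝 0) := by
        have := (hw.pow j).sub_const (w₀ ^ j)
        simpa using this
      have h2 := h1.norm
      simpa using h2
  exact squeeze_zero_norm' (by filter_upwards [hbound] with k hk; simpa using hk) hB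

/-! ## Part C. Exponential points with every large label -/

/-- Labels are `2π`-separated: two integers within `1` of the same point coincide. [folklore] -/
theorem int_eq_of_norm_sub_lt {w : ℂ} {k k' : ℤ} (hk : ‖w - k * (2 * Real.pi * I)‖ < 1)
    (hk' : ‖w - k' * (2 * Real.pi * I)‖ < 1) : k = k' := by
  by_contra hne
  have h2 : ‖(k : ℂ) * (2 * Real.pi * I) - k' * (2 * Real.pi * I)‖ < 2 := by
    have := norm_sub_le_norm_sub_add_norm_sub ((k : ℂ) * (2 * Real.pi * I)) w (k' * (2 * Real.pi * I))
    rw [norm_sub_rev] at hk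
    linarith
  have h3 : ‖(k : ℂ) * (2 * Real.pi * I) - k' * (2 * Real.pi * I)‖ = |(k : ℝ) - k'| * (2 * Real.pi) := by
    rw [← sub_mul, norm_mul, show ((k : ℂ) - k') = (((k : ℝ) - k' : ℝ) : ℂ) by push_cast; ring,
      Complex.norm_real, Real.norm_eq_abs]
    simp [abs_of_pos Real.pi_pos]
  rw [h3] at h2
  have h4 : (1 : ℝ) ≤ |(k : ℝ) - k'| := by
    rw [show (k : ℝ) - k' = ((k - k' : ℤ) : ℝ) by push_cast; ring]
    exact_mod_cast Int.one_le_abs (sub_ne_zero.2 hne)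
  nlinarith [Real.pi_gt_three]

/-- **Exponential points with every large label.**  `deg A = deg B = N ≥ 1`, `lc B = -e^{τ'} lc A`:
for every `ε > 0` there is `K` such that for every `k ≥ K` some `z` with `‖z - τ' - 2πik‖ < ε` solves
`A(z)e^z + B(z) = 0` (zero persistence for `Ã(u,ζ)e^{τ'}e^ζ + B̃(u,ζ)` at `u = 1/(τ' + 2πik) → 0`,
whose limit `lc A·e^{τ'}(e^ζ - 1)` has the simple zero `ζ = 0`). (new) -/
theorem exists_expPoint_near_label (A B : Polynomial ℂ) (hN : 1 ≤ A.natDegree)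
    (hdeg : B.natDegree = A.natDegree) (τ' : ℂ)
    (hlc : B.leadingCoeff = -Complex.exp τ' * A.leadingCoeff) {ε : ℝ} (hε : 0 < ε) :
    ∃ K : ℕ, ∀ k : ℕ, K ≤ k → ∃ z : ℂ, ‖z - τ' - (k : ℂ) * (2 * Real.pi * I)‖ < ε ∧
      A.eval z * Complex.exp z + B.eval z = 0 := by
  classical
  set N := A.natDegree with hNdef
  set θ : ℂ := Complex.exp τ' with hθ
  have hθ0 : θ ≠ 0 := Complex.exp_ne_zero _
  have hA0 : A ≠ 0 := by
    intro h; rw [h, Polynomial.natDegree_zero] at hNdef; omega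
  have hlcA : A.leadingCoeff ≠ 0 := Polynomial.leadingCoeff_ne_zero.2 hA0
  -- the rescaled functions
  set ΦA : ℂ → ℂ → ℂ := fun u ζ => ∑ i ∈ Finset.range (N + 1), A.coeff i * u ^ (N - i) * (1 + u * ζ) ^ i
    with hΦA
  set ΦB : ℂ → ℂ → ℂ := fun u ζ => ∑ i ∈ Finset.range (N + 1), B.coeff i * u ^ (N - i) * (1 + u * ζ) ^ i
    with hΦB
  set Φ : ℂ → ℂ → ℂ := fun u ζ => ΦA u ζ * θ * Complex.exp ζ + ΦB u ζ with hΦ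
  have hcont : Continuous fun p : ℂ × ℂ => Φ p.1 p.2 := by
    simp only [hΦ, hΦA, hΦB]
    fun_prop
  have hdiff : ∀ u, Differentiable ℂ (Φ u) := by
    intro u
    simp only [hΦ, hΦA, hΦB]
    fun_prop
  -- the key identity `ΦA(u, ζ) = u^N A(1/u + ζ)` for `u ≠ 0`
  have hresc : ∀ (C : Polynomial ℂ), C.natDegree ≤ N → ∀ u ζ : ℂ, u ≠ 0 →
      (∑ i ∈ Finset.range (N + 1), C.coeff i * u ^ (N - i) * (1 + u * ζ) ^ i) =
        u ^ N * C.eval (u⁻¹ + ζ) := by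
    intro C hC u ζ hu
    rw [Polynomial.eval_eq_sum_range' (Nat.lt_succ_of_le hC), Finset.mul_sum]
    refine Finset.sum_congr rfl fun i hi => ?_
    have hi' : i ≤ N := Nat.lt_succ_iff.1 (Finset.mem_range.1 hi)
    have e1 : (u⁻¹ + ζ) ^ i = u⁻¹ ^ i * (1 + u * ζ) ^ i := by
      rw [← mul_pow]; congr 1; field_simp
    rw [e1, inv_pow, pow_sub₀ _ hu hi']
    ring
  -- the limit function at `u = 0`
  have hΦ0 : ∀ ζ, Φ 0 ζ = A.leadingCoeff * θ * (Complex.exp ζ - 1) := by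
    intro ζ
    have h0 : ∀ (C : Polynomial ℂ), (∑ i ∈ Finset.range (N + 1),
        C.coeff i * (0 : ℂ) ^ (N - i) * (1 + 0 * ζ) ^ i) = C.coeff N := by
      intro C
      rw [Finset.sum_eq_single N]
      · simp
      · intro i hi hne
        have : N - i ≠ 0 := by have := Finset.mem_range.1 hi; omega
        rw [zero_pow this]; ring
      · intro h; exact absurd (Finset.self_mem_range_succ N) h
    simp only [hΦ, hΦA, hΦB, h0]
    have hB : B.coeff N = B.leadingCoeff := by rw [Polynomial.leadingCoeff, hdeg]
    rw [hB, hlc]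
    change A.coeff A.natDegree * θ * Complex.exp ζ + -θ * A.leadingCoeff = _
    rw [← Polynomial.leadingCoeff]
    ring
  have hzero : Φ 0 0 = 0 := by rw [hΦ0]; simp
  have hne : ∃ ζ, Φ 0 ζ ≠ 0 := by
    refine ⟨Real.pi * I, ?_⟩
    rw [hΦ0, Complex.exp_pi_mul_I]
    exact mul_ne_zero (mul_ne_zero hlcA hθ0) (by norm_num)
  obtain ⟨δ, hδ, hnear⟩ := exists_zero_near_of_near_param hcont hdiff hne hzero hε
  -- large labels give small parameters
  obtain ⟨K, hK⟩ : ∃ K : ℕ, ∀ k : ℕ, K ≤ k → δ⁻¹ + ‖τ'‖ < 2 * Real.pi * k := by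
    obtain ⟨K, hK⟩ := exists_nat_gt ((δ⁻¹ + ‖τ'‖) / (2 * Real.pi))
    refine ⟨K, fun k hk => ?_⟩
    rw [div_lt_iff₀ Real.two_pi_pos] at hK
    have : (K : ℝ) ≤ k := by exact_mod_cast hk
    nlinarith [Real.pi_pos]
  refine ⟨K, fun k hk => ?_⟩
  set s : ℂ := τ' + (k : ℂ) * (2 * Real.pi * I) with hs
  have hsnorm : δ⁻¹ < ‖s‖ := by
    have h1 : ‖(k : ℂ) * (2 * Real.pi * I)‖ = 2 * Real.pi * k := by
      rw [norm_mul, Complex.norm_natCast]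
      simp [abs_of_pos Real.pi_pos]
      ring
    have h2 : ‖(k : ℂ) * (2 * Real.pi * I)‖ - ‖τ'‖ ≤ ‖s‖ := by
      rw [hs]
      have := norm_sub_norm_le ((k : ℂ) * (2 * Real.pi * I)) (-τ')
      rw [norm_neg, sub_neg_eq_add, add_comm] at this
      linarith
    linarith [hK k hk]
  have hs0 : s ≠ 0 := by
    intro h; rw [h, norm_zero] at hsnorm; exact absurd hsnorm (not_lt.2 (by positivity))
  have hus : ‖s⁻¹ - 0‖ < δ := by
    rw [sub_zero, norm_inv]
    have hspos : 0 < ‖s‖ := norm_pos_iff.2 hs0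
    calc ‖s‖⁻¹ < (δ⁻¹)⁻¹ := (inv_lt_inv₀ hspos (by positivity)).2 hsnorm
      _ = δ := inv_inv δ
  obtain ⟨ζ, hζ, hΦζ⟩ := hnear s⁻¹ hus
  refine ⟨s + ζ, ?_, ?_⟩
  · have e : s + ζ - τ' - (k : ℂ) * (2 * Real.pi * I) = ζ := by rw [hs]; ring
    rw [e]; simpa using hζ
  -- unfold the zero of `Φ`
  have hu0 : s⁻¹ ≠ 0 := inv_ne_zero hs0
  have hA' : ΦA s⁻¹ ζ = s⁻¹ ^ N * A.eval (s + ζ) := by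
    rw [hΦA]; simp only; rw [hresc A le_rfl _ _ hu0, inv_inv]
  have hB' : ΦB s⁻¹ ζ = s⁻¹ ^ N * B.eval (s + ζ) := by
    rw [hΦB]; simp only; rw [hresc B (by rw [hdeg]) _ _ hu0, inv_inv]
  have hexp : θ * Complex.exp ζ = Complex.exp (s + ζ) := by
    have hper : Complex.exp ((k : ℂ) * (2 * Real.pi * I)) = 1 := by
      have := Complex.exp_int_mul_two_pi_mul_I (k : ℤ)
      exact_mod_cast this
    rw [hθ, hs, show τ' + (k : ℂ) * (2 * Real.pi * I) + ζ =
      (τ' + ζ) + (k : ℂ) * (2 * Real.pi * I) by ring, Complex.exp_add, Complex.exp_add, hper, mul_one]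
  have h1 : Φ s⁻¹ ζ = s⁻¹ ^ N * (A.eval (s + ζ) * Complex.exp (s + ζ) + B.eval (s + ζ)) := by
    rw [hΦ]; simp only; rw [hA', hB', ← hexp]; ring
  rw [h1] at hΦζ
  exact (mul_eq_zero.1 hΦζ).resolve_left (pow_ne_zero _ hu0)

end Summit.Schanuel.Schanuel.Theorems
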